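import Mathlib.AlgebraicGeometry.OrderOfVanishing
import Mathlib.RingTheory.Localization.LocalizationLocalization
import Literature.AlgebraicGeometry.Motives.CyclesEquivalencesFlatPullbackProofs
import Literature.AlgebraicGeometry.Motives.SubschemeCyclesProofs
import HarnessLib

/-!
# Stalks at generisations, orders of vanishing of fractions, and fibre rings of a pull-back

Local ingredients for Fulton's Theorem 1.7 (flat pull-back preserves rational equivalence,
`Literature.AlgebraicGeometry.Motives.flatPullback_mem_ratTrivial_of_finiteType`), whose proof compares,
at a point `w'` of `W' = f⁻¹(W)`, the coefficient `ord_W(φ) · ℓ(𝒪_{X_{f x}, x})` of `f^*[div φ]`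
with `Σ_η ℓ(𝒪_{W',η}) · ord_{V_η}(φ_η)` summed over the irreducible components `V_η = closure {η}`
of `W'` through `w'` (Fulton, *Intersection Theory*, §1.7, Thm. 1.7 with Lemma 1.7.2; Stacks 02RB,
02RE). Everything is reduced to the local ring `B = 𝒪_{W',w'}`:

* `Literature.AlgebraicGeometry.Motives.isLocalizationAtPrime_stalkSpecializes`: for a generisation `η ⤳ z` in a scheme,
  `𝒪_{X,η}` is the localisation of `𝒪_{X,z}` at the prime `𝔭_η = (𝒪_{X,z} → 𝒪_{X,η})⁻¹ 𝔪_η`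
  (Stacks 01J7), along `stalkSpecializes`;
* `comap_maximalIdeal_mem_minimalPrimes`, `exists_eq_comap_maximalIdeal_of_mem_minimalPrimes`,
  `eq_of_comap_maximalIdeal_eq`: `η ↦ 𝔭_η` is a bijection between the generic points of irreducible
  components through `z` (points `η ⤳ z` maximal for the specialisation order) and the minimal
  primes of `𝒪_{X,z}` (via Mathlib's `Scheme.fromSpecStalk`, `range_fromSpecStalk`);
  `length_localization_comap_maximalIdeal`: `ℓ((𝒪_{X,z})_{𝔭_η}) = ℓ(𝒪_{X,η})`, the geometric
  multiplicity of the component;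
* `Scheme.ord_div_algebraMap`: Mathlib's order of vanishing `Scheme.ord` of a quotient `a/b` of nonzero
  elements of `𝒪_{X,z}` at a codimension-one point `z` of an integral locally Noetherian scheme is
  `ℓ(𝒪_{X,z}/(a)) - ℓ(𝒪_{X,z}/(b))` (Fulton §1.2, `ord_V(r) = ℓ_A(A/(a)) - ℓ_A(A/(b))`);
  `exists_functionField_ringHom`: a dominant morphism of integral schemes induces `K(W) → K(V)`
  compatibly with the stalk maps; `Scheme.ord_map_div`: the order of the pulled-back function;
* `length_quotient_map_maximalIdeal_of_isPullback`: for a cartesian square `fst ≫ g = snd ≫ f` with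
  `g` a preimmersion, the fibre rings of `𝒪_{T,fst w} → 𝒪_{P,w}` and of `𝒪_{Y,y} → 𝒪_{X,snd w}` have
  the same length (both are `𝒪_{X,x}/𝔪_y 𝒪_{X,x}`, by `ker_stalkMap_of_isPullback`).

## References

* W. Fulton, *Intersection Theory*, 2nd ed. (1998), §1.2 (order of vanishing), §1.5, §1.7.
* The Stacks Project, Tags 01J7 (points of `Spec 𝒪_{X,x}`), 02RB, 02RE.
-/

universe u

open CategoryTheory AlgebraicGeometry Limits Order TopologicalSpace Topology IsLocalRing

namespace Literature.AlgebraicGeometry.Motives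

/-! ### The stalk at a generisation is a localisation of the stalk -/

section Generization

variable {X : Scheme.{u}}

/-- Membership in the prime `primeIdealOf x ⊆ Γ(X, U)` of a point of an affine open: `s` lies in it iff
its germ at `x` is not a unit. [folklore] -/
lemma mem_primeIdealOf_iff {U : X.Opens} (hU : IsAffineOpen U) (x : U) (s : Γ(X, U)) :
    s ∈ (hU.primeIdealOf x).asIdeal ↔ (X.presheaf.germ U x x.2).hom s ∈ maximalIdeal (X.presheaf.stalk x) := by
  rw [hU.primeIdealOf_eq_map_closedPoint]
  rfl

/-- **Stacks 01J7, algebraically**: for a generisation `η ⤳ z` in a scheme `X`, the local ring `𝒪_{X,η}`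
is the localisation of `𝒪_{X,z}` at the prime `𝔭_η = (𝒪_{X,z} → 𝒪_{X,η})⁻¹ 𝔪_η`, along Mathlib's
specialisation map `stalkSpecializes : 𝒪_{X,z} ⟶ 𝒪_{X,η}` (inside an affine open `Spec A ∋ z`:
`𝒪_{X,z} = A_𝔭`, `𝒪_{X,η} = A_𝔮` with `𝔮 ⊆ 𝔭`, and `A_𝔮 = (A_𝔭)_{𝔮A_𝔭}`). [cite: StacksProject, Tag 01J7] -/
theorem isLocalizationAtPrime_stalkSpecializes {η z : X} (h : η ⤳ z) :
    letI := (X.presheaf.stalkSpecializes h).hom.toAlgebra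
    IsLocalization.AtPrime (X.presheaf.stalk η)
      ((maximalIdeal (X.presheaf.stalk η)).comap (X.presheaf.stalkSpecializes h).hom) := by
  obtain ⟨_, ⟨U, hU, rfl⟩, hzU, -⟩ :=
    X.isBasis_affineOpens.exists_subset_of_mem_open (Set.mem_univ z) isOpen_univ
  have hU : IsAffineOpen U := hU
  have hηU : η ∈ U := h.mem_open U.2 hzU
  let A := Γ(X, U)
  let Oz := X.presheaf.stalk z
  let Oη := X.presheaf.stalk η
  letI aZ : Algebra A Oz := (X.presheaf.germ U z hzU).hom.toAlgebra
  letI aH : Algebra A Oη := (X.presheaf.germ U η hηU).hom.toAlgebra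
  letI aZH : Algebra Oz Oη := (X.presheaf.stalkSpecializes h).hom.toAlgebra
  let 𝔭 := hU.primeIdealOf ⟨z, hzU⟩
  let 𝔮 := hU.primeIdealOf ⟨η, hηU⟩
  haveI hz : IsLocalization.AtPrime Oz 𝔭.asIdeal := hU.isLocalization_stalk ⟨z, hzU⟩
  haveI hη : IsLocalization.AtPrime Oη 𝔮.asIdeal := hU.isLocalization_stalk ⟨η, hηU⟩
  have htower : ∀ s : A, algebraMap Oz Oη (algebraMap A Oz s) = algebraMap A Oη s := fun s ↦ by
    change ((X.presheaf.germ U z hzU) ≫ X.presheaf.stalkSpecializes h).hom s = _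
    rw [X.presheaf.germ_stalkSpecializes hzU h]
    rfl
  haveI : IsScalarTower A Oz Oη := IsScalarTower.of_algebraMap_eq fun s ↦ (htower s).symm
  -- `𝔮 ⊆ 𝔭`, i.e. `A \ 𝔭 ⊆ A \ 𝔮`
  have hle : 𝔭.asIdeal.primeCompl ≤ 𝔮.asIdeal.primeCompl := by
    intro s hs hs'
    refine hs ?_
    change s ∈ 𝔮.asIdeal at hs'
    change s ∈ 𝔭.asIdeal
    rw [mem_primeIdealOf_iff] at hs' ⊢
    by_contra hunit
    have hu : IsUnit (algebraMap A Oz s) := (IsLocalRing.notMem_maximalIdeal.mp hunit)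
    have := hu.map (algebraMap Oz Oη)
    rw [htower] at this
    exact IsLocalRing.notMem_maximalIdeal.mpr this hs'
  -- `𝒪_{X,η}` is a localisation of `𝒪_{X,z}` at the image of `A \ 𝔮`
  have h1 := IsLocalization.isLocalization_of_submonoid_le Oz Oη _ _ hle
  -- and hence at the prime `𝔮 𝒪_{X,z} = (𝒪_{X,z} → 𝒪_{X,η})⁻¹ 𝔪_η`
  refine IsLocalization.of_le (𝔮.asIdeal.primeCompl.map (algebraMap A Oz)) _ ?_ ?_
  · rintro _ ⟨s, hs, rfl⟩ hs'
    replace hs' : algebraMap Oz Oη (algebraMap A Oz s) ∈ maximalIdeal Oη := hs'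
    rw [htower] at hs'
    exact hs ((mem_primeIdealOf_iff hU ⟨η, hηU⟩ s).mpr hs')
  · intro s hs
    exact IsLocalRing.notMem_maximalIdeal.mp hs


variable {z : X}

/-- The point of `Spec 𝒪_{X,z}` defined by a generisation `η ⤳ z`: the prime
`(𝒪_{X,z} → 𝒪_{X,η})⁻¹ 𝔪_η`; under `Spec 𝒪_{X,z} → X` it maps to `η` (Mathlib
`SpecMap_stalkSpecializes_fromSpecStalk`). [folklore] -/
lemma fromSpecStalk_comap_maximalIdeal {η : X} (h : η ⤳ z) :
    X.fromSpecStalk z ⟨(maximalIdeal (X.presheaf.stalk η)).comap (X.presheaf.stalkSpecializes h).hom,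
      inferInstance⟩ = η := by
  have : (⟨(maximalIdeal (X.presheaf.stalk η)).comap (X.presheaf.stalkSpecializes h).hom,
      inferInstance⟩ : Spec (X.presheaf.stalk z)) =
      Spec.map (X.presheaf.stalkSpecializes h) (closedPoint (X.presheaf.stalk η)) := rfl
  rw [this, ← Scheme.Hom.comp_apply, Scheme.SpecMap_stalkSpecializes_fromSpecStalk,
    Scheme.fromSpecStalk_closedPoint]

/-- Injectivity of `η ↦ 𝔭_η` on the generisations of `z` (`Spec 𝒪_{X,z} → X` is injective). [folklore] -/
lemma eq_of_comap_maximalIdeal_eq {η₁ η₂ : X} (h₁ : η₁ ⤳ z) (h₂ : η₂ ⤳ z)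
    (h : (maximalIdeal (X.presheaf.stalk η₁)).comap (X.presheaf.stalkSpecializes h₁).hom =
      (maximalIdeal (X.presheaf.stalk η₂)).comap (X.presheaf.stalkSpecializes h₂).hom) : η₁ = η₂ := by
  rw [← fromSpecStalk_comap_maximalIdeal h₁, ← fromSpecStalk_comap_maximalIdeal h₂]
  congr 2

/-- For `η ⤳ z` maximal in the specialisation order (the generic point of an irreducible component
through `z`), `𝔭_η` is a minimal prime of `𝒪_{X,z}` (`Spec 𝒪_{X,z} → X` is a homeomorphism onto the
generisations of `z`, Stacks 01J7). [cite: StacksProject, Tag 01J7] -/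
lemma comap_maximalIdeal_mem_minimalPrimes {η : X} (h : η ⤳ z) (hη : IsMax η) :
    (maximalIdeal (X.presheaf.stalk η)).comap (X.presheaf.stalkSpecializes h).hom ∈
      minimalPrimes (X.presheaf.stalk z) := by
  rw [minimalPrimes_eq_minimals]
  refine ⟨inferInstance, fun Q hQ hle ↦ ?_⟩
  let q : Spec (X.presheaf.stalk z) := ⟨Q, hQ⟩
  let p : Spec (X.presheaf.stalk z) :=
    ⟨(maximalIdeal (X.presheaf.stalk η)).comap (X.presheaf.stalkSpecializes h).hom, inferInstance⟩
  have hqp : q ⤳ p := (PrimeSpectrum.le_iff_specializes q p).mp hle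
  have h1 : X.fromSpecStalk z q ⤳ η := by
    rw [← fromSpecStalk_comap_maximalIdeal h]
    exact hqp.map (X.fromSpecStalk z).continuous
  have h2 : η ⤳ X.fromSpecStalk z q :=
    Scheme.le_iff_specializes.mp (hη (Scheme.le_iff_specializes.mpr h1))
  have heq : X.fromSpecStalk z q = X.fromSpecStalk z p := by
    rw [fromSpecStalk_comap_maximalIdeal h]
    exact (h1.antisymm h2).eq (X := X)
  have hqp' : q = p := (X.fromSpecStalk z).isEmbedding.injective heq
  exact le_of_eq (congrArg PrimeSpectrum.asIdeal hqp').symm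

/-- Every minimal prime of `𝒪_{X,z}` is `𝔭_η` for a generisation `η` of `z` maximal in the
specialisation order (the generic point of an irreducible component through `z`). [cite: StacksProject, Tag 01J7] -/
lemma exists_eq_comap_maximalIdeal_of_mem_minimalPrimes {P : Ideal (X.presheaf.stalk z)}
    (hP : P ∈ minimalPrimes (X.presheaf.stalk z)) :
    ∃ (η : X) (h : η ⤳ z), IsMax η ∧
      P = (maximalIdeal (X.presheaf.stalk η)).comap (X.presheaf.stalkSpecializes h).hom := by
  haveI hPp : P.IsPrime := hP.1.1
  let p : Spec (X.presheaf.stalk z) := ⟨P, hPp⟩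
  have hηz : X.fromSpecStalk z p ⤳ z := by
    have : X.fromSpecStalk z p ∈ Set.range (X.fromSpecStalk z) := ⟨p, rfl⟩
    rwa [Scheme.range_fromSpecStalk] at this
  refine ⟨X.fromSpecStalk z p, hηz, ?_, ?_⟩
  · intro η' hη'
    have h1 : η' ⤳ X.fromSpecStalk z p := Scheme.le_iff_specializes.mp hη'
    have h1z : η' ⤳ z := h1.trans hηz
    obtain ⟨q, hq⟩ : η' ∈ Set.range (X.fromSpecStalk z) := by
      rw [Scheme.range_fromSpecStalk]; exact h1z
    rw [← hq] at h1 ⊢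
    have hqp : q ⤳ p := (X.fromSpecStalk z).isEmbedding.isInducing.specializes_iff.mp h1
    have hle : q.asIdeal ≤ P := (PrimeSpectrum.le_iff_specializes q p).mpr hqp
    have hqP : q.asIdeal = P := le_antisymm hle (hP.2 ⟨q.2, bot_le⟩ hle)
    have : q = p := PrimeSpectrum.ext hqP
    rw [this]
  · have hinj := (X.fromSpecStalk z).isEmbedding.injective
    have key : X.fromSpecStalk z p = X.fromSpecStalk z ⟨(maximalIdeal (X.presheaf.stalk
        (X.fromSpecStalk z p))).comap (X.presheaf.stalkSpecializes hηz).hom, inferInstance⟩ := by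
      rw [fromSpecStalk_comap_maximalIdeal hηz]
    exact congrArg PrimeSpectrum.asIdeal (hinj key)

/-- **The geometric multiplicity of a component, read in a local ring**: for a generisation `η ⤳ z`,
`ℓ((𝒪_{X,z})_{𝔭_η}) = ℓ(𝒪_{X,η})` (lengths of the rings over themselves; Fulton §1.5,
`m = ℓ(𝒪_{X,V})`), by `isLocalizationAtPrime_stalkSpecializes`. [cite: Fulton1998, §1.5] -/
lemma length_localization_comap_maximalIdeal {η : X} (h : η ⤳ z) :
    Module.length (Localization.AtPrime ((maximalIdeal (X.presheaf.stalk η)).comap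
        (X.presheaf.stalkSpecializes h).hom))
      (Localization.AtPrime ((maximalIdeal (X.presheaf.stalk η)).comap
        (X.presheaf.stalkSpecializes h).hom)) =
      Module.length (X.presheaf.stalk η) (X.presheaf.stalk η) := by
  letI := (X.presheaf.stalkSpecializes h).hom.toAlgebra
  haveI := isLocalizationAtPrime_stalkSpecializes h
  set P := (maximalIdeal (X.presheaf.stalk η)).comap (X.presheaf.stalkSpecializes h).hom
  have e := (IsLocalization.algEquiv P.primeCompl (Localization.AtPrime P)
    (X.presheaf.stalk η)).toRingEquiv
  apply WithBot.coe_injective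
  rw [Module.coe_length, Module.coe_length]
  exact (Order.krullDim_eq_of_orderIso e.idealComapOrderIso).symm


end Generization

/-! ### Orders of vanishing of fractions and of pulled-back functions -/

section Ord

variable {X : Scheme.{u}} [IsIntegral X] [IsLocallyNoetherian X]

/-- **Order of vanishing of a fraction** (Fulton, *Intersection Theory*, §1.2: for `r = a/b` with
`a, b ∈ A = 𝒪_{V,X}`, `ord_V(r) = ℓ_A(A/(a)) - ℓ_A(A/(b))`). On an integral locally Noetherian scheme,
Mathlib's `Scheme.ord` of the quotient `a/b ∈ K(X)` of nonzero elements of `𝒪_{X,z}` at a point `z` of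
codimension one is `ℓ(𝒪_{X,z}/(a)) - ℓ(𝒪_{X,z}/(b))` (Mathlib's `Ring.ord`, both finite). [cite: Fulton1998, §1.2] -/
theorem Scheme.ord_div_algebraMap {z : X} (hz : coheight z = 1) {a b : X.presheaf.stalk z} (ha : a ≠ 0)
    (hb : b ≠ 0) :
    Scheme.ord (algebraMap _ X.functionField a / algebraMap _ X.functionField b) z =
      ((Ring.ord (X.presheaf.stalk z) a).toNat : ℤ) - (Ring.ord (X.presheaf.stalk z) b).toNat := by
  haveI : Ring.KrullDimLE 1 (X.presheaf.stalk z) := krullDimLE_of_coheight_le hz.le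
  have hinj := FaithfulSMul.algebraMap_injective (X.presheaf.stalk z) X.functionField
  have ha' : algebraMap _ X.functionField a ≠ 0 := (map_ne_zero_iff _ hinj).mpr ha
  have hb' : algebraMap _ X.functionField b ≠ 0 := (map_ne_zero_iff _ hinj).mpr hb
  have ha0 : a ∈ nonZeroDivisors _ := mem_nonZeroDivisors_of_ne_zero ha
  have hb0 : b ∈ nonZeroDivisors _ := mem_nonZeroDivisors_of_ne_zero hb
  rw [Scheme.ord_eq_iff hz (div_ne_zero ha' hb'), map_div₀]
  change Ring.ordFrac (X.presheaf.stalk z) _ / Ring.ordFrac (X.presheaf.stalk z) _ = _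
  rw [Ring.ordFrac_eq_ord _ ha, Ring.ordFrac_eq_ord _ hb,
    Ring.ordMonoidWithZeroHom_eq_coe _ ha0 (ENat.coe_toNat (Ring.ord_ne_top ha0)).symm,
    Ring.ordMonoidWithZeroHom_eq_coe _ hb0 (ENat.coe_toNat (Ring.ord_ne_top hb0)).symm,
    ← WithZero.coe_div, ← ofAdd_sub]


variable {V W : Scheme.{u}} [IsIntegral V] [IsIntegral W] (g : V ⟶ W)

/-- A dominant morphism `g : V ⟶ W` of integral schemes (generic point to generic point) induces a
homomorphism of function fields `K(W) → K(V)` (the stalk map at the generic point) compatible with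
all stalk maps: `g^*(s) = g♯_v(s)` in `K(V)` for `s ∈ 𝒪_{W, g v}` (naturality of stalk maps along
specialisations). Stated as an existence, which is all that is used. [folklore] -/
theorem exists_functionField_ringHom (hgen : g (genericPoint V) = genericPoint W) :
    ∃ ψ : W.functionField →+* V.functionField, ∀ (v : V) (s : W.presheaf.stalk (g v)),
      ψ (algebraMap _ W.functionField s) = algebraMap _ V.functionField ((g.stalkMap v).hom s) := by
  refine ⟨((W.presheaf.stalkCongr (.of_eq hgen)).inv ≫ g.stalkMap (genericPoint V)).hom, ?_⟩
  intro v s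
  have hsv : genericPoint V ⤳ v := genericPoint_specializes v
  have key : W.presheaf.stalkSpecializes (genericPoint_specializes (g v)) ≫
      (W.presheaf.stalkCongr (.of_eq hgen)).inv ≫ g.stalkMap (genericPoint V) =
      g.stalkMap v ≫ V.presheaf.stalkSpecializes hsv := by
    rw [← Scheme.Hom.stalkSpecializes_stalkMap g _ v hsv, ← Category.assoc]
    congr 1
    simp [TopCat.Presheaf.stalkCongr]
  have := DFunLike.congr_fun (CommRingCat.hom_ext_iff.mp key) s
  change (g.stalkMap (genericPoint V)).hom ((W.presheaf.stalkCongr (.of_eq hgen)).inv.hom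
      ((W.presheaf.stalkSpecializes (genericPoint_specializes (g v))).hom s)) =
    (V.presheaf.stalkSpecializes hsv).hom ((g.stalkMap v).hom s)
  simpa using this

variable [IsLocallyNoetherian V]

/-- **Order of a pulled-back rational function.** For `ψ : K(W) → K(V)` compatible with the stalk map
of `g` at `v` and `a, b ∈ 𝒪_{W, g v}` with `g♯a, g♯b ≠ 0`, the order of `ψ(a/b)` at a codimension-one
point `v` is `ℓ(𝒪_{V,v}/(g♯a)) - ℓ(𝒪_{V,v}/(g♯b))` (Fulton §1.2 applied on `V`). [cite: Fulton1998, §1.2] -/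
theorem Scheme.ord_map_div (ψ : W.functionField →+* V.functionField) (v : V)
    (hψ : ∀ s : W.presheaf.stalk (g v),
      ψ (algebraMap _ W.functionField s) = algebraMap _ V.functionField ((g.stalkMap v).hom s))
    (hv : coheight v = 1) {a b : W.presheaf.stalk (g v)}
    (ha : (g.stalkMap v).hom a ≠ 0) (hb : (g.stalkMap v).hom b ≠ 0) :
    Scheme.ord (ψ (algebraMap _ W.functionField a / algebraMap _ W.functionField b)) v =
      ((Ring.ord (V.presheaf.stalk v) ((g.stalkMap v).hom a)).toNat : ℤ) -
        (Ring.ord (V.presheaf.stalk v) ((g.stalkMap v).hom b)).toNat := by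
  rw [map_div₀, hψ a, hψ b]
  exact Scheme.ord_div_algebraMap hv ha hb


end Ord

/-! ### Fibre rings of a pull-back along a preimmersion -/

section FiberRing

variable {P T X Y : Scheme.{u}} {fst : P ⟶ T} {snd : P ⟶ X} {g : T ⟶ Y} {f : X ⟶ Y}

/-- For a surjection `σ : R → S` with `ker σ ⊆ I`, `S/σ(I)S ≅ R/I`, so the lengths agree. [folklore] -/
lemma length_quotient_map_eq_of_surjective {R S : Type*} [CommRing R] [CommRing S] (σ : R →+* S)
    (hσ : Function.Surjective σ) (I : Ideal R) (hker : RingHom.ker σ ≤ I) :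
    Module.length S (S ⧸ I.map σ) = Module.length R (R ⧸ I) := by
  -- the composite `R → S → S/I S` is surjective with kernel `I`
  let π : R →+* S ⧸ I.map σ := (Ideal.Quotient.mk (I.map σ)).comp σ
  have hπ : Function.Surjective π := Ideal.Quotient.mk_surjective.comp hσ
  have hkerπ : RingHom.ker π = I := by
    rw [← RingHom.comap_ker, Ideal.mk_ker, Ideal.comap_map_of_surjective σ hσ,
      sup_eq_left.mpr (by rwa [← RingHom.ker_eq_comap_bot])]
  have e : (R ⧸ I) ≃+* S ⧸ I.map σ := (Ideal.quotEquivOfEq hkerπ.symm).trans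
    (RingHom.quotientKerEquivOfSurjective hπ)
  rw [Module.length_eq_of_surjective (S := S) (R := S ⧸ I.map σ) (M := S ⧸ I.map σ)
      Ideal.Quotient.mk_surjective,
    Module.length_eq_of_surjective (S := R) (R := R ⧸ I) (M := R ⧸ I) Ideal.Quotient.mk_surjective]
  exact (SubschemeCyclesProofs.length_self_eq_of_ringEquiv e).symm

/-- **Fibre rings in a base change by a preimmersion.** For a cartesian square `fst ≫ g = snd ≫ f` with
`g : T ⟶ Y` a preimmersion (e.g. a closed immersion) and `w ∈ P` over `x = snd w`, `t = fst w`,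
`y = f x = g t`, the fibre ring `𝒪_{P,w}/𝔪_t 𝒪_{P,w}` of `𝒪_{T,t} → 𝒪_{P,w}` has the same length as the
fibre ring `𝒪_{X,x}/𝔪_y 𝒪_{X,x}` of `𝒪_{Y,y} → 𝒪_{X,x}`: indeed `𝒪_{P,w} = 𝒪_{X,x}/J𝒪_{X,x}` with
`J = ker(𝒪_{Y,y} → 𝒪_{T,t}) ⊆ 𝔪_y` (`ker_stalkMap_of_isPullback`) and `𝔪_t = image of 𝔪_y`. With
`length_stalk_fiber` this identifies `ℓ(𝒪_{P,w}/𝔪_t𝒪_{P,w})` with the multiplicity `ℓ(𝒪_{X_y, x})` of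
the scheme-theoretic fibre (Fulton §1.7, coefficient of `f^*`). [folklore] -/
theorem length_quotient_map_maximalIdeal_of_isPullback (H : IsPullback fst snd g f)
    [IsPreimmersion g] (w : P) :
    Module.length (P.presheaf.stalk w) ((P.presheaf.stalk w) ⧸
        (maximalIdeal (T.presheaf.stalk (fst w))).map (fst.stalkMap w).hom) =
      Module.length (X.presheaf.stalk (snd w)) ((X.presheaf.stalk (snd w)) ⧸
        (maximalIdeal (Y.presheaf.stalk (f (snd w)))).map (f.stalkMap (snd w)).hom) := by
  have hy : f (snd w) = g (fst w) := by
    rw [← Scheme.Hom.comp_apply, ← H.w, Scheme.Hom.comp_apply]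
  set σ := snd.stalkMap w with hσdef
  set τ := (Y.presheaf.stalkCongr (.of_eq hy)).hom ≫ g.stalkMap (fst w) with hτdef
  have hσs : Function.Surjective σ.hom := stalkMap_surjective_of_isPullback H w
  have hτs : Function.Surjective τ.hom :=
    (g.stalkMap_surjective (fst w)).comp (ConcreteCategory.bijective_of_isIso _).2
  -- the square of stalk maps commutes
  have hsq : τ ≫ fst.stalkMap w = f.stalkMap (snd w) ≫ σ := by
    have h1 := Scheme.Hom.stalkMap_congr_hom (snd ≫ f) (fst ≫ g) H.w.symm w
    rw [Scheme.Hom.stalkMap_comp, Scheme.Hom.stalkMap_comp] at h1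
    rw [hτdef, Category.assoc]
    exact h1.symm
  -- `𝔪_{fst w} = τ(𝔪_y)`
  haveI : IsLocalHom τ.hom := by
    rw [hτdef, CommRingCat.hom_comp]
    exact RingHom.isLocalHom_comp _ _
  have hmA : maximalIdeal (T.presheaf.stalk (fst w)) =
      (maximalIdeal (Y.presheaf.stalk (f (snd w)))).map τ.hom :=
    (map_maximalIdeal_of_surjective τ.hom hτs).symm
  -- hence `𝔪_{fst w} 𝒪_{P,w} = σ(𝔪_y 𝒪_{X,x})`
  have hI : (maximalIdeal (T.presheaf.stalk (fst w))).map (fst.stalkMap w).hom =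
      ((maximalIdeal (Y.presheaf.stalk (f (snd w)))).map (f.stalkMap (snd w)).hom).map σ.hom := by
    rw [hmA, Ideal.map_map, Ideal.map_map, ← CommRingCat.hom_comp, ← CommRingCat.hom_comp, hsq]
  rw [hI]
  refine length_quotient_map_eq_of_surjective σ.hom hσs _ ?_
  -- `ker σ = J 𝒪_{X,x} ⊆ 𝔪_y 𝒪_{X,x}`
  have hker := ker_stalkMap_of_isPullback H w (snd w) rfl hy
  have e0 : (X.presheaf.stalkCongr (.of_eq (rfl : snd w = snd w))).inv ≫ snd.stalkMap w = σ := by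
    rw [hσdef]
    simp [TopCat.Presheaf.stalkCongr]
  rw [e0] at hker
  rw [hker]
  refine Ideal.map_mono (le_maximalIdeal ?_)
  exact (RingHom.ker_ne_top _)


end FiberRing

end Literature.AlgebraicGeometry.Motives
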